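import Summits.AnomalousDissipation.AnomalousDissipation.Theorems.SolenoidalFractalHomogenisationLagrangianStepOneLevelSplitDefsL
import Summits.AnomalousDissipation.AnomalousDissipation.Theorems.SolenoidalFractalHomogenisationLagrangianStepOneLevelSplitApi
import Literature.Analysis.FluidPDE.StatisticalSolutionEnergyEq
import Literature.Analysis.FunctionSpaces.TorusVectorParseval
import HarnessLib

/-!
# K1L_D `LagrangianRenormalisationStepDesign` (stmt-AnomalousDissipation-27980), stub `stub_oneLevelL_IW` v3-cut-2: elementary API of `gridL` / `seqL`,
# the trimmed datum in `V2`, and the class-`R` spectral tail (helper; `--supports stmt-AnomalousDissipation-27980 --as helper`)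

Sequel of `…LagrangianStepOneLevelSplitApi` (p648179) for the amended cut (tenure D24-11; lead F-lead-4/5/7, spec P1–P4), namespace
`…LagrangianStep.OneLevelSplit`, used by the glue `…LagrangianStepOneLevelSplitGlueL` and offered to the lead's proof of S23″:
* `gridL` order facts (`gridL_zero`, `gridL_of_fits`, `gridL_of_not_fits`, `gridL_le`, `gridL_nonneg`, `gridL_mono`), the natural last index
  `gridL_floor_succ : gridL r t (⌊t/r⌋₊+1) = t`, and the WINDOW LENGTHS the lead asked for: every window is shorter than `2r`
  (`gridL_succ_sub_lt`) and, when `r ≤ t`, empty or of length `≥ r` (`gridL_succ_sub_dichotomy`);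
* `seqL_zero`, `seqL_succ` (unfoldings);
* `fourierTruncate_congr_ae` (the truncation only sees the a.e. class), `datumLp_fourierTruncate` (the class of the trimmed datum `P_N w₀` IS
  `cutLp N` of the class of `w₀` — so the trim is an ORTHOGONAL split in `V2`, `inner_cutLp_self`);
* `norm_sub_cutLp_sq_le_of_inClass` — the class-`R` spectral tail in `V2`: `4π²(N²+1)·‖x − cutLp N x‖² ≤ R·‖x‖²`
  (`Torus.integral_norm_sq_fourierTruncate_sub_le` + `Torus.tailGradNormSq_le` of `StatisticalSolutionEnergyEq` + `InClass`).
All proofs elementary; no sorry; nothing about the crux, Onsager's conjecture or anomalous dissipation is claimed.  Text by planner seat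
`ad-ideate-p4` g11 (2026-08-28, reference file `Cruxes/LagrangianRenormalisationStep/OneLevelSplitSketch.lean` rev6 §1b); landed by a prover seat.
-/

set_option linter.dupNamespace false

noncomputable section

namespace Summit.AnomalousDissipation.AnomalousDissipation.Theorems.SolenoidalFractalHomogenisation.LagrangianStep

open Literature.Analysis Literature.Analysis.FluidPDE Literature.Analysis.FunctionSpaces
open MeasureTheory Set Filter
open scoped ENNReal NNReal InnerProductSpace
open Summit.AnomalousDissipation.AnomalousDissipation.Theorems.SolenoidalFractalHomogenisation.RealisedQuasiStaticCellLaw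
  (memLp_two_of_memSobolev_one_complexify)

namespace OneLevelSplit

/-- `w_0 = 0`. -/
theorem gridL_zero (r t : ℝ) : gridL r t 0 = 0 := if_pos rfl

/-- A window index whose successor window fits: `w_k = k·r`. -/
theorem gridL_of_fits {r t : ℝ} {k : ℕ} (hk : k ≠ 0) (h : ((k : ℝ) + 1) * r ≤ t) : gridL r t k = (k : ℝ) * r := by
  rw [gridL, if_neg hk, if_pos h]

/-- A window index whose successor window does not fit: `w_k = t`. -/
theorem gridL_of_not_fits {r t : ℝ} {k : ℕ} (hk : k ≠ 0) (h : ¬ ((k : ℝ) + 1) * r ≤ t) : gridL r t k = t := by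
  rw [gridL, if_neg hk, if_neg h]

/-- `w_k ≤ t` (for `0 ≤ r`, `0 ≤ t`). -/
theorem gridL_le {r t : ℝ} (hr : 0 ≤ r) (ht : 0 ≤ t) (k : ℕ) : gridL r t k ≤ t := by
  unfold gridL
  split_ifs with h0 h1
  · exact ht
  · exact le_trans (by nlinarith) h1
  · exact le_rfl

/-- `0 ≤ w_k` (for `0 ≤ r`, `0 ≤ t`). -/
theorem gridL_nonneg {r t : ℝ} (hr : 0 ≤ r) (ht : 0 ≤ t) (k : ℕ) : 0 ≤ gridL r t k := by
  unfold gridL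
  split_ifs
  · exact le_rfl
  · positivity
  · exact ht

/-- The grid is monotone: `w_k ≤ w_{k+1}` (for `0 ≤ r`, `0 ≤ t`). -/
theorem gridL_mono {r t : ℝ} (hr : 0 ≤ r) (ht : 0 ≤ t) (k : ℕ) : gridL r t k ≤ gridL r t (k + 1) := by
  rcases Nat.eq_zero_or_pos k with rfl | hk
  · rw [gridL_zero]; exact gridL_nonneg hr ht _
  have hk0 : k ≠ 0 := Nat.pos_iff_ne_zero.1 hk
  by_cases h2 : (((k + 1 : ℕ) : ℝ) + 1) * r ≤ t
  · have h1 : ((k : ℝ) + 1) * r ≤ t := le_trans (by push_cast; nlinarith) h2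
    rw [gridL_of_fits hk0 h1, gridL_of_fits k.succ_ne_zero h2]; push_cast; nlinarith
  · rw [gridL_of_not_fits k.succ_ne_zero h2]
    exact gridL_le hr ht k

/-- The natural last index: `w_{⌊t/r⌋₊+1} = t` (for `0 < r`). -/
theorem gridL_floor_succ {r t : ℝ} (hr : 0 < r) : gridL r t (⌊t / r⌋₊ + 1) = t := by
  refine gridL_of_not_fits (Nat.succ_ne_zero _) (not_le.2 ?_)
  have h := Nat.lt_floor_add_one (t / r)
  rw [div_lt_iff₀ hr] at h
  push_cast at h ⊢
  nlinarith

/-- Every window is shorter than `2r` (for `0 < r`). -/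
theorem gridL_succ_sub_lt {r t : ℝ} (hr : 0 < r) (k : ℕ) : gridL r t (k + 1) - gridL r t k < 2 * r := by
  rcases Nat.eq_zero_or_pos k with rfl | hk
  · rw [gridL_zero, sub_zero]
    by_cases h : (((0 + 1 : ℕ) : ℝ) + 1) * r ≤ t
    · rw [gridL_of_fits (Nat.succ_ne_zero 0) h]; push_cast; linarith
    · rw [gridL_of_not_fits (Nat.succ_ne_zero 0) h]; push_cast at h; linarith
  have hk0 : k ≠ 0 := Nat.pos_iff_ne_zero.1 hk
  by_cases h1 : ((k : ℝ) + 1) * r ≤ t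
  · rw [gridL_of_fits hk0 h1]
    by_cases h2 : (((k + 1 : ℕ) : ℝ) + 1) * r ≤ t
    · rw [gridL_of_fits k.succ_ne_zero h2]; push_cast; linarith
    · rw [gridL_of_not_fits k.succ_ne_zero h2]; push_cast at h2; linarith
  · have h2 : ¬ (((k + 1 : ℕ) : ℝ) + 1) * r ≤ t := fun h2 => h1 (le_trans (by push_cast; nlinarith) h2)
    rw [gridL_of_not_fits hk0 h1, gridL_of_not_fits k.succ_ne_zero h2]; linarith

/-- When at least one full window fits (`r ≤ t`), every window is EMPTY or has length `≥ r` (the last one has length in `[r, 2r)`). -/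
theorem gridL_succ_sub_dichotomy {r t : ℝ} (hr : 0 < r) (hrt : r ≤ t) (k : ℕ) :
    gridL r t (k + 1) = gridL r t k ∨ r ≤ gridL r t (k + 1) - gridL r t k := by
  rcases Nat.eq_zero_or_pos k with rfl | hk
  · right
    rw [gridL_zero, sub_zero]
    by_cases h : (((0 + 1 : ℕ) : ℝ) + 1) * r ≤ t
    · rw [gridL_of_fits (Nat.succ_ne_zero 0) h]; push_cast; linarith
    · rw [gridL_of_not_fits (Nat.succ_ne_zero 0) h]; exact hrt
  have hk0 : k ≠ 0 := Nat.pos_iff_ne_zero.1 hk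
  by_cases h1 : ((k : ℝ) + 1) * r ≤ t
  · right
    rw [gridL_of_fits hk0 h1]
    by_cases h2 : (((k + 1 : ℕ) : ℝ) + 1) * r ≤ t
    · rw [gridL_of_fits k.succ_ne_zero h2]; push_cast; linarith
    · rw [gridL_of_not_fits k.succ_ne_zero h2]; linarith
  · left
    have h2 : ¬ (((k + 1 : ℕ) : ℝ) + 1) * r ≤ t := fun h2 => h1 (le_trans (by push_cast; nlinarith [hr.le]) h2)
    rw [gridL_of_not_fits hk0 h1, gridL_of_not_fits k.succ_ne_zero h2]

/-- `seqL U x r t 0 = x`. -/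
theorem seqL_zero (U : ℝ → ℝ → (V2 →L[ℝ] V2)) (x : V2) (r t : ℝ) : seqL U x r t 0 = x := rfl

/-- `seqL U x r t (j+1) = U 0 w_{j+1} x`. -/
theorem seqL_succ (U : ℝ → ℝ → (V2 →L[ℝ] V2)) (x : V2) (r t : ℝ) (j : ℕ) :
    seqL U x r t (j + 1) = U 0 (gridL r t (j + 1)) x := rfl

/-- The Fourier truncation only sees the a.e. class. -/
theorem fourierTruncate_congr_ae {u v : VF} (h : u =ᵐ[volume] v) (N : ℕ) :
    Torus.fourierTruncate N u = Torus.fourierTruncate N v := by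
  rw [Torus.fourierTruncate_eq, Torus.fourierTruncate_eq]
  simp_rw [Torus.mFourierCoeff_congr_ae (h.fun_comp EuclideanSpace.complexify)]

/-- **The trimmed datum's class is the cut of the datum's class**: `datumLp (P_N w₀) = cutLp N (datumLp w₀)` in `V2`. -/
theorem datumLp_fourierTruncate {w₀ : VF} (hw₀ : IsDatum w₀) (N : ℕ) (h₁ : IsDatum (Torus.fourierTruncate N w₀)) :
    datumLp (Torus.fourierTruncate N w₀) h₁ = cutLp N (datumLp w₀ hw₀) := by
  rw [datumLp, cutLp, MemLp.toLp_eq_toLp_iff]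
  rw [fourierTruncate_congr_ae (coeFn_datumLp w₀ hw₀) N]

/-- **The class-`R` spectral tail in `V2`**: `4π²(N²+1)·‖x − cutLp N x‖² ≤ R·‖x‖²` for the class `x` of a class-`R` datum (the modes with
`|k| > N` carry gradient weight `≥ 4π²(N²+1)`: `Torus.integral_norm_sq_fourierTruncate_sub_le` + `Torus.tailGradNormSq_le` + `InClass`). -/
theorem norm_sub_cutLp_sq_le_of_inClass {R : ℝ≥0} {w₀ : VF} (hw₀ : IsDatum w₀) (hR : InClass R w₀) (N : ℕ) :
    4 * Real.pi ^ 2 * ((N : ℝ) ^ 2 + 1) * ‖datumLp w₀ hw₀ - cutLp N (datumLp w₀ hw₀)‖ ^ 2 ≤ (R : ℝ) * ‖datumLp w₀ hw₀‖ ^ 2 := by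
  set x : V2 := datumLp w₀ hw₀ with hx
  have hw2 : MemLp w₀ 2 volume := memLp_two_of_memSobolev_one_complexify hw₀.1
  have hfin : (R : ℝ≥0∞) * ENNReal.ofReal (Torus.vectorL2Sq w₀) ≠ ⊤ := ENNReal.mul_ne_top ENNReal.coe_ne_top ENNReal.ofReal_ne_top
  have hgrad : Torus.eGradNormSq w₀ ≠ ⊤ := ne_top_of_le_ne_top hfin hR
  have htail : Torus.tailGradNormSq N w₀ ≠ ⊤ := ne_top_of_le_ne_top hgrad (Torus.tailGradNormSq_le N w₀)
  have h1 := Torus.integral_norm_sq_fourierTruncate_sub_le hw2 N htail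
  have h2 : (Torus.tailGradNormSq N w₀).toReal ≤ (R : ℝ) * Torus.vectorL2Sq w₀ := by
    have := ENNReal.toReal_mono hfin ((Torus.tailGradNormSq_le N w₀).trans hR)
    rwa [ENNReal.toReal_mul, ENNReal.coe_toReal, ENNReal.toReal_ofReal (show (0:ℝ) ≤ Torus.vectorL2Sq w₀ by unfold Torus.vectorL2Sq; positivity)] at this
  have h3 : ‖x - cutLp N x‖ ^ 2 = ∫ a, ‖Torus.fourierTruncate N w₀ a - w₀ a‖ ^ 2 := by
    rw [norm_sq_eq_integral]
    refine integral_congr_ae ?_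
    filter_upwards [Lp.coeFn_sub x (cutLp N x), coeFn_datumLp w₀ hw₀, coeFn_cutLp N x] with a ha hxa hca
    rw [ha, Pi.sub_apply, hca, hxa, fourierTruncate_congr_ae (coeFn_datumLp w₀ hw₀) N, norm_sub_rev]
  have hpos : 0 < 4 * Real.pi ^ 2 * ((N : ℝ) ^ 2 + 1) := by positivity
  rw [h3, norm_datumLp_sq, mul_comm]
  calc (∫ a, ‖Torus.fourierTruncate N w₀ a - w₀ a‖ ^ 2) * (4 * Real.pi ^ 2 * ((N : ℝ) ^ 2 + 1))
      ≤ (Torus.tailGradNormSq N w₀).toReal / (4 * Real.pi ^ 2 * ((N : ℝ) ^ 2 + 1)) * (4 * Real.pi ^ 2 * ((N : ℝ) ^ 2 + 1)) :=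
        mul_le_mul_of_nonneg_right h1 hpos.le
    _ = (Torus.tailGradNormSq N w₀).toReal := div_mul_cancel₀ _ hpos.ne'
    _ ≤ (R : ℝ) * Torus.vectorL2Sq w₀ := h2

end OneLevelSplit

end Summit.AnomalousDissipation.AnomalousDissipation.Theorems.SolenoidalFractalHomogenisation.LagrangianStep

end
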